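import Mathlib.Topology.Algebra.Group.Basic
import Literature.NumberTheory.GaloisRepresentations.WeilGroup
import Literature.NumberTheory.GaloisRepresentations.LocalGaloisGroupProofs
import Literature.NumberTheory.GaloisRepresentations.AbsGaloisGroupCompact
import HarnessLib

/-!
# Discharges of named facts in `WeilGroup.lean`: the Weil topology (trunk GalRep, item C7)

D-0014 keeps `Literature/` sorry-free by stating cited results as named facts `def X : Prop`.
This sibling file of `Literature.NumberTheory.GaloisRepresentations.WeilGroup` proves the facts
about the Weil topology on `W_F` that follow from its definition
(`WeilGroup.instTopologicalSpace`: the topology generated by the sets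
`B(w, V) = {x | x w⁻¹ ∈ I_F, x ∈ V}`, `w ∈ W_F`, `V ⊆ Γ_F` Krull-open — the disjoint
union of the cosets of `I_F`, each with its Krull topology) together with the discharged facts of
`LocalGaloisGroupProofs.lean` (`IsFrobPow.mul_holds`, `IsFrobPow.unique_holds`,
`absInertia_normal_holds`):

* `WeilGroup.exists_isOpen_inter_coset_eq`: every Weil-open set meets each coset `I_F w₀` in a
  basic set `B(w₀, V)` (induction over the generated topology); this is the working description
  of the Weil topology.
* (`WeilGroup.continuous_toAbsGalois_holds` — `W_F → Γ_F` is continuous — already lives in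
  `Literature/NumberTheory/Automorphic/LParameter.lean` and is not restated here;)
* `WeilGroup.isEmbedding_toAbsGalois_restrict_inertia_holds` — on `I_F` the Weil topology is the
  Krull topology;
* `WeilGroup.isTopologicalGroup_holds` — `W_F` is a topological group (`I_F` is normal);
* `WeilGroup.continuous_deg_holds` — `deg : W_F → ℤ` is continuous (locally constant on
  cosets);
* `WeilGroup.isCompact_inertia_holds` — `I_F ⊆ W_F` is compact (closed image in the compact
  `Γ_F`, `absoluteGaloisGroup_compactSpace` of `AbsGaloisGroupCompact.lean`, valid in every
  characteristic).

Not discharged here: `denseRange_toAbsGalois` (needs the surjectivity of `Γ_F` onto the Galois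
groups of the residue extensions, i.e. the existence of Frobenius lifts), `continuous_map` and
`weilSubgroup_map_absGaloisRestrict_le` (need `IsFrobPow.absGaloisRestrict`).

## References

* J. Tate, *Number theoretic background*, Proc. Sympos. Pure Math. XXXIII (Corvallis 1977),
  Part 2, AMS 1979, (1.4.1).  [Corvallis1979]
* P. Deligne, *Les constantes des équations fonctionnelles des fonctions L*, Antwerp II,
  LNM 349, 1973, §2.2.4.
-/

noncomputable section

open ValuativeRel Field Topology Set Filter TopologicalSpace

namespace Literature.NumberTheory.GaloisRepresentations

namespace WeilGroup


variable {F : Type*} [Field F] [ValuativeRel F] [TopologicalSpace F] [IsNonarchimedeanLocalField F]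

/-! ### Basic open sets of the Weil topology -/

/-- Basic sets with `V` open are Weil-open (they generate the topology).
Ref: Tate, *Number theoretic background* (Corvallis 1979), (1.4.1). [folklore] -/
theorem isOpen_basicOpen (w : WeilGroup F) {V : Set (absoluteGaloisGroup F)} (hV : IsOpen V) :
    IsOpen {x : WeilGroup F | x * w⁻¹ ∈ inertia F ∧ toAbsGalois F x ∈ V} :=
  isOpen_generateFrom_of_mem ⟨w, V, hV, rfl⟩

/-- The coset condition only depends on the coset: if `w w₀⁻¹ ∈ I_F` then
`x w⁻¹ ∈ I_F ↔ x w₀⁻¹ ∈ I_F`.  [folklore] -/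
theorem mul_inv_mem_inertia_iff {w w₀ x : WeilGroup F} (h : w * w₀⁻¹ ∈ inertia F) :
    x * w⁻¹ ∈ inertia F ↔ x * w₀⁻¹ ∈ inertia F := by
  have h1 : x * w₀⁻¹ = x * w⁻¹ * (w * w₀⁻¹) := by group
  constructor
  · intro hx
    rw [h1]
    exact mul_mem hx h
  · intro hx
    have h2 : x * w⁻¹ = x * w₀⁻¹ * (w * w₀⁻¹)⁻¹ := by group
    rw [h2]
    exact mul_mem hx (inv_mem h)

/-- **Working description of the Weil topology.**  Every Weil-open set `U` meets each coset
`I_F w₀` in a basic set: `U ∩ I_F w₀ = B(w₀, V)` for some Krull-open `V ⊆ Γ_F` (induction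
over the generated topology: basic sets of another coset miss `I_F w₀`, those of the same coset
are of this form, and the form is stable under intersections and unions).
Ref: Tate, *Number theoretic background* (Corvallis 1979), (1.4.1). [folklore] -/
theorem exists_isOpen_inter_coset_eq {U : Set (WeilGroup F)} (hU : IsOpen U) (w₀ : WeilGroup F) :
    ∃ V : Set (absoluteGaloisGroup F), IsOpen V ∧
      U ∩ {x | x * w₀⁻¹ ∈ inertia F} =
        {x : WeilGroup F | x * w₀⁻¹ ∈ inertia F ∧ toAbsGalois F x ∈ V} := by
  induction hU with
  | basic s hs =>
    obtain ⟨w, V, hV, rfl⟩ := hs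
    by_cases hw : w * w₀⁻¹ ∈ inertia F
    · refine ⟨V, hV, ?_⟩
      ext x
      simp only [mem_inter_iff, mem_setOf_eq, mul_inv_mem_inertia_iff hw]
      tauto
    · refine ⟨∅, isOpen_empty, ?_⟩
      ext x
      simp only [mem_inter_iff, mem_setOf_eq, mem_empty_iff_false, and_false,
        iff_false, not_and]
      intro hx hx₀
      apply hw
      have h1 : w * w₀⁻¹ = (x * w⁻¹)⁻¹ * (x * w₀⁻¹) := by group
      rw [h1]
      exact mul_mem (inv_mem hx.1) hx₀
  | univ =>
    refine ⟨univ, isOpen_univ, ?_⟩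
    ext x
    simp
  | inter s t _ _ ihs iht =>
    obtain ⟨V₁, hV₁, h₁⟩ := ihs
    obtain ⟨V₂, hV₂, h₂⟩ := iht
    refine ⟨V₁ ∩ V₂, hV₁.inter hV₂, ?_⟩
    ext x
    have e₁ := Set.ext_iff.mp h₁ x
    have e₂ := Set.ext_iff.mp h₂ x
    simp only [mem_inter_iff, mem_setOf_eq] at e₁ e₂ ⊢
    tauto
  | sUnion S _ ih =>
    choose V hV hVS using ih
    refine ⟨⋃ (s : Set (WeilGroup F)) (hs : s ∈ S), V s hs,
      isOpen_iUnion fun s => isOpen_iUnion fun hs => hV s hs, ?_⟩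
    ext x
    simp only [mem_inter_iff, mem_sUnion, mem_setOf_eq, mem_iUnion]
    constructor
    · rintro ⟨⟨s, hs, hxs⟩, hx⟩
      have e := Set.ext_iff.mp (hVS s hs) x
      simp only [mem_inter_iff, mem_setOf_eq] at e
      exact ⟨hx, s, hs, (e.mp ⟨hxs, hx⟩).2⟩
    · rintro ⟨hx, s, hs, hxV⟩
      have e := Set.ext_iff.mp (hVS s hs) x
      simp only [mem_inter_iff, mem_setOf_eq] at e
      exact ⟨⟨s, hs, (e.mpr ⟨hx, hxV⟩).1⟩, hx⟩

/-- A Weil-open subset of `I_F` is the trace of a Krull-open set: `U ∩ I_F = I_F ∩ V`.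
Ref: Tate, *Number theoretic background* (Corvallis 1979), (1.4.1). [folklore] -/
theorem exists_isOpen_inter_inertia_eq {U : Set (WeilGroup F)} (hU : IsOpen U) :
    ∃ V : Set (absoluteGaloisGroup F), IsOpen V ∧
      U ∩ (inertia F : Set (WeilGroup F)) = {x | x ∈ inertia F ∧ toAbsGalois F x ∈ V} := by
  obtain ⟨V, hV, h⟩ := exists_isOpen_inter_coset_eq hU 1
  refine ⟨V, hV, ?_⟩
  have e : {x : WeilGroup F | x * 1⁻¹ ∈ inertia F} = (inertia F : Set (WeilGroup F)) := by
    ext x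
    simp
  rw [e] at h
  rw [h]
  ext x
  simp

/-! ### Discharges -/

variable (F)

/-- **Discharge of `WeilGroup.isEmbedding_toAbsGalois_restrict_inertia`**: on `I_F` the Weil
topology is the Krull topology (`W_F → Γ_F` restricted to `I_F` is an embedding).
Ref: Tate, *Number theoretic background* (Corvallis 1979), (1.4.1).
[cite: Corvallis1979, (1.4.1)] -/
theorem isEmbedding_toAbsGalois_restrict_inertia_holds :
    isEmbedding_toAbsGalois_restrict_inertia F := by
  -- continuity of `W_F → Γ_F` (`WeilGroup.continuous_toAbsGalois_holds`, proved in
  -- `Literature/NumberTheory/Automorphic/LParameter.lean`; re-derived here to keep the import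
  -- graph inside `GaloisRepresentations/`): the preimage of an open `V` is `⋃_w B(w, V)`.
  have hcont0 : Continuous (toAbsGalois F) := by
    refine continuous_def.mpr fun V hV => ?_
    have h : toAbsGalois F ⁻¹' V =
        ⋃ w : WeilGroup F, {x : WeilGroup F | x * w⁻¹ ∈ inertia F ∧ toAbsGalois F x ∈ V} := by
      ext x
      simp only [mem_preimage, mem_iUnion, mem_setOf_eq]
      exact ⟨fun hx => ⟨x, by simp, hx⟩, fun ⟨_, _, hx⟩ => hx⟩
    rw [h]
    exact isOpen_iUnion fun w => isOpen_basicOpen w hV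
  have hcont : Continuous ((inertia F : Set (WeilGroup F)).restrict (toAbsGalois F)) :=
    hcont0.comp continuous_subtype_val
  refine ⟨⟨le_antisymm (continuous_iff_le_induced.mp hcont) fun s hs => ?_⟩,
    (toAbsGalois_injective (F := F)).comp Subtype.val_injective⟩
  -- `s` open in the subspace `I_F ⊆ W_F`: `s = I_F ∩ U`, `U` Weil-open, `U ∩ I_F = I_F ∩ V`
  obtain ⟨U, hU, rfl⟩ := isOpen_induced_iff.mp hs
  obtain ⟨V, hV, hUV⟩ := exists_isOpen_inter_inertia_eq hU
  refine isOpen_induced_iff.mpr ⟨V, hV, ?_⟩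
  ext ⟨x, hx⟩
  have e := Set.ext_iff.mp hUV x
  simp only [mem_inter_iff, SetLike.mem_coe, mem_setOf_eq] at e
  simp only [mem_preimage, restrict_apply]
  constructor
  · intro hxV
    exact (e.mpr ⟨hx, hxV⟩).1
  · intro hxU
    exact (e.mp ⟨hxU, hx⟩).2

/-- **Discharge of `WeilGroup.isTopologicalGroup`**: `W_F` with the Weil topology is a
topological group (inversion and multiplication map basic sets into basic sets, using that
`I_F` is normal in `W_F`, `absInertia_normal_holds`).
Ref: Tate, *Number theoretic background* (Corvallis 1979), (1.4.1).
[cite: Corvallis1979, (1.4.1)] -/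
theorem isTopologicalGroup_holds : isTopologicalGroup F := by
  have hN : (inertia F).Normal := inertia_normal (absInertia_normal_holds F)
  have hinv : ContinuousInv (WeilGroup F) := by
    refine ⟨continuous_generateFrom_iff.mpr ?_⟩
    rintro _ ⟨w, V, hV, rfl⟩
    have h :
        (fun x : WeilGroup F => x⁻¹) ⁻¹'
            {x | x * w⁻¹ ∈ inertia F ∧ toAbsGalois F x ∈ V} =
        {x : WeilGroup F | x * w⁻¹⁻¹ ∈ inertia F ∧ toAbsGalois F x ∈ V⁻¹} := by
      ext x
      simp only [mem_preimage, mem_setOf_eq, inv_inv, map_inv, Set.mem_inv]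
      refine and_congr_left fun _ => ?_
      rw [← mul_inv_rev, inv_mem_iff]
      -- `w * x ∈ I ↔ x * w ∈ I`
      constructor
      · intro h
        have : x * w = w⁻¹ * (w * x) * w⁻¹⁻¹ := by group
        rw [this]
        exact hN.conj_mem _ h _
      · intro h
        have : w * x = x⁻¹ * (x * w) * x⁻¹⁻¹ := by group
        rw [this]
        exact hN.conj_mem _ h _
    rw [h]
    exact isOpen_basicOpen _ hV.inv
  have hmul : ContinuousMul (WeilGroup F) := by
    refine ⟨continuous_generateFrom_iff.mpr ?_⟩
    rintro _ ⟨w, V, hV, rfl⟩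
    rw [isOpen_iff_forall_mem_open]
    rintro ⟨x₀, y₀⟩ hxy
    simp only [mem_preimage, mem_setOf_eq] at hxy
    obtain ⟨hI, hV'⟩ := hxy
    -- continuity of multiplication in `Γ_F`
    have hV2 :
        IsOpen ((fun p : absoluteGaloisGroup F × absoluteGaloisGroup F => p.1 * p.2) ⁻¹' V) :=
      hV.preimage continuous_mul
    obtain ⟨V₁, V₂, hV₁, hV₂, hx₁, hy₂, hsub⟩ :=
      isOpen_prod_iff.mp hV2 (toAbsGalois F x₀) (toAbsGalois F y₀)
        (by simpa [map_mul] using hV')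
    refine ⟨{x : WeilGroup F | x * x₀⁻¹ ∈ inertia F ∧ toAbsGalois F x ∈ V₁} ×ˢ
        {x : WeilGroup F | x * y₀⁻¹ ∈ inertia F ∧ toAbsGalois F x ∈ V₂}, ?_,
      (isOpen_basicOpen _ hV₁).prod (isOpen_basicOpen _ hV₂), ?_⟩
    · rintro ⟨x, y⟩ ⟨⟨hx, hxV⟩, ⟨hy, hyV⟩⟩
      simp only [mem_preimage, mem_setOf_eq, map_mul]
      refine ⟨?_, hsub (mk_mem_prod hxV hyV)⟩
      have h1 : x * y * w⁻¹ =
          (x * x₀⁻¹) * (x₀ * (y * y₀⁻¹) * x₀⁻¹) * (x₀ * y₀ * w⁻¹) := by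
        group
      rw [h1]
      exact mul_mem (mul_mem hx (hN.conj_mem _ hy _)) hI
    · simp only [mem_prod, mem_setOf_eq, mul_inv_cancel, one_mem, true_and]
      exact ⟨hx₁, hy₂⟩
  exact { }

/-- **Discharge of `WeilGroup.continuous_deg`**: `deg : W_F → ℤ` is continuous, i.e. locally
constant: the fibre through `w` is the open coset `I_F w = B(w, Γ_F)`.
Ref: Tate, *Number theoretic background* (Corvallis 1979), (1.4.1).
[cite: Corvallis1979, (1.4.1)] -/
theorem continuous_deg_holds : continuous_deg F := by
  have hmul : IsFrobPow.mul (F := F) := IsFrobPow.mul_holds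
  have huniq : IsFrobPow.unique (F := F) := IsFrobPow.unique_holds
  refine continuous_discrete_rng.mpr fun n => ?_
  have h : deg ⁻¹' {n} = ⋃ (w : WeilGroup F) (_ : deg w = n),
      {x : WeilGroup F | x * w⁻¹ ∈ inertia F ∧ toAbsGalois F x ∈ univ} := by
    ext x
    simp only [mem_preimage, mem_singleton_iff, mem_iUnion, mem_setOf_eq, mem_univ, and_true,
      exists_prop]
    constructor
    · intro hx
      exact ⟨x, hx, by simp⟩
    · rintro ⟨w, hw, hxw⟩
      rw [← deg_eq_zero_iff_mem_inertia hmul huniq, deg_mul hmul huniq, deg_inv hmul huniq,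
        hw] at hxw
      omega
  rw [h]
  exact isOpen_iUnion fun w => isOpen_iUnion fun _ => isOpen_basicOpen w isOpen_univ

/-- **Discharge of `WeilGroup.isCompact_inertia`**: `I_F ⊆ W_F` is compact — under the embedding
`I_F → Γ_F` (`isEmbedding_toAbsGalois_restrict_inertia_holds`) its image `absInertia F` is
closed (`isClosed_absInertia_holds`) in the compact group `Γ_F`
(`absoluteGaloisGroup_compactSpace`, every characteristic).
Ref: Tate, *Number theoretic background* (Corvallis 1979), (1.4.1).
[cite: Corvallis1979, (1.4.1)] -/
theorem isCompact_inertia_holds : isCompact_inertia F := by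
  haveI : CompactSpace (absoluteGaloisGroup F) := absoluteGaloisGroup_compactSpace F
  have hemb : IsEmbedding ((inertia F : Set (WeilGroup F)).restrict (toAbsGalois F)) :=
    isEmbedding_toAbsGalois_restrict_inertia_holds F
  change IsCompact (inertia F : Set (WeilGroup F))
  rw [isCompact_iff_isCompact_univ, hemb.isCompact_iff, Set.image_univ]
  have hrange : Set.range ((inertia F : Set (WeilGroup F)).restrict (toAbsGalois F)) =
      (absInertia F : Set (absoluteGaloisGroup F)) := by
    ext σ
    simp only [Set.mem_range, Set.restrict_apply, Subtype.exists, SetLike.mem_coe]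
    constructor
    · rintro ⟨w, hw, rfl⟩
      exact hw
    · intro hσ
      exact ⟨WeilGroup.mk σ ⟨0, isFrobPow_zero_iff_mem_absInertia.mpr hσ⟩,
        by simpa [mem_inertia_iff] using hσ, rfl⟩
  rw [hrange]
  exact (isClosed_absInertia_holds F).isCompact

end WeilGroup

end Literature.NumberTheory.GaloisRepresentations
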